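import Mathlib
import HarnessLib

/-!
# Exact comb sum helpers for CombDescentStep

Helper lemmas for computing the exact comb sum via cotangent Mittag-Leffler.

For an exact comb with zeros at `x₀ + k·s` for `k ∈ ℤ \ {0}`, the sum
`Σ_{k≠0} 1/(z₀ - (x₀ + ks))` where `z₀ = x₀ + ih` equals `-iπ coth(πh/s)/s + i/h`.

This file provides the key identity `cot(iy) = -i coth(y)` needed for this computation.

## Main results

* `pure_imag_mem_integerComplement`: `(h/s) * I ∈ ℂ_ℤ` when `h, s > 0`
* `cot_mul_I_eq`: `cot(y * I) = -I * (cosh y / sinh y)` for `y ≠ 0`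
-/

open Complex Real Set Filter Topology
open scoped BigOperators Topology

noncomputable section

namespace EarlyAppointmentsExactComb

/-- Pure imaginary z = ih/s is never an integer when h, s > 0. -/
theorem pure_imag_mem_integerComplement {h s : ℝ} (hh : 0 < h) (hs : 0 < s) :
    (h / s : ℝ) * Complex.I ∈ Complex.integerComplement := by
  rw [Complex.mem_integerComplement_iff]
  rintro ⟨n, hn⟩
  have hre := congrArg Complex.re hn
  have him := congrArg Complex.im hn
  simp only [Complex.mul_re, Complex.I_re, mul_zero, Complex.I_im, mul_one,
    Complex.ofReal_re, Complex.ofReal_im, Complex.intCast_re, Complex.intCast_im] at hre him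
  simp only [Complex.mul_im, Complex.I_re, mul_zero, Complex.I_im, mul_one,
    Complex.ofReal_im, Complex.ofReal_re, add_zero] at him
  have hpos : 0 < h / s := div_pos hh hs
  linarith

/-- `cot(iy) = -i coth(y)` for y ≠ 0.
Uses cos(yI) = cosh(y) and sin(yI) = I * sinh(y). -/
theorem cot_mul_I_eq {y : ℝ} (hy : y ≠ 0) :
    Complex.cot ((y : ℂ) * Complex.I) = -Complex.I * (Real.cosh y / Real.sinh y) := by
  have hs : Real.sinh y ≠ 0 := Real.sinh_ne_zero.mpr hy
  have hsC : Complex.sinh (y : ℂ) ≠ 0 := by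
    rw [← Complex.ofReal_sinh]
    exact Complex.ofReal_ne_zero.mpr hs
  rw [Complex.cot_eq_cos_div_sin, Complex.cos_mul_I, Complex.sin_mul_I]
  rw [← Complex.ofReal_cosh, ← Complex.ofReal_sinh]
  have hI : Complex.I ≠ 0 := Complex.I_ne_zero
  field_simp
  ring_nf
  rw [Complex.I_sq]
  ring

end EarlyAppointmentsExactComb

end
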